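import Summits.CriticalPhenomena.SAWScalingLimit.Theorems.SAWLoopFugacityFlowAvoidanceLimitAnchorDefs
import Literature.Probability.LatticeModels.DiluteLoopModelSAWLaw
import Literature.Probability.Percolation.CLE6Proofs

/-!
# The SAW end of the line: `R_δ(0, 0, x_c)` is the avoidance probability — stub `stub_sawEndpoint`
of line `symplectic-fermion-anchor` (crux `SAWLoopFugacityFlow.AvoidanceLimit`, stmt-CriticalPhenomena-10649)

For a bounded domain `Ω`, a mesh `δ > 0`, lattice points `a ≠ b` and any `S ⊆ ℂ`, the probability,
under the critical self-avoiding-walk law `SAW.law Ω δ a b` (`P_δ(γ) ∝ x_c^{|γ|}`, `x_c = 1/μ`), that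
the polyline of the walk stays in `closure S` EQUALS the doubly normalised two-leg ratio
`Rδ 0 0 x_c Ω S δ a b` of the loop(`n`) + dimer(`t`) dressed SAW of the line at `(n, t) = (0, 0)`:

* at dimer fugacity `t = 0` only the empty dimer configuration survives, so the dressed partition
  function IS the tree's strictly dilute loop model `⟨n, 0, x⟩` (`dimerPF_dimerFugacity_zero`,
  `twoLegDim_dimerFugacity_zero`, `Rδ_dimerFugacity_zero`), and at `n = 0` the two-leg function is
  the generating function of self-avoiding paths (`twoLegDim_zero_zero_eq_sum_paths`, from the tree's
  `DiluteLoopModel.partitionFunction_zero_zero_eq_sum_paths` / `partitionFunction_zero_zero_empty`);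
* a self-avoiding path of `Ω_δ` is a path of the CONFINED graph `confinedGraph Ω S δ` iff its
  polyline lies in `closure S` (`filter_pathsIn_rangeSubset_eq_image`: the polyline is the union of
  the closed edge segments, `SimpleGraph.Walk.range_toCurve_cons`);
* the critical SAW measure of the event is therefore `ofReal` of the confined path sum
  (`weight_preimage_rangeSubset`), its total mass is the unconfined one
  (`SAW.weight_univ_eq_domainPartitionFunction`), and the junk cases (`a ∉ Ω_δ`, or no SAW from
  `a` to `b`) give `0 = 0`.

Sources: N. Madras, G. Slade, *The Self-Avoiding Walk* (1993), §1.2–1.3 [MadrasSlade1993];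
H. Duminil-Copin, S. Smirnov, Ann. of Math. 175 (2012), §4 (the measure `P_{x,δ}`)
[DuminilCopinSmirnov2012]. No new definitions; nothing about `n ≠ 0` is asserted here.
-/

noncomputable section

open scoped BigOperators Topology symmDiff
open Filter Finset MeasureTheory
open Literature.Probability.RandomPlanarGeometry Literature.Probability.LatticeModels

namespace Summit.CriticalPhenomena.SAWScalingLimit.Theorems.AvoidanceLimit.Anchor

/-! ## The `t = 0` slice of the dressed SAW is the tree's strictly dilute loop model -/

section DimerFugacityZero

variable {K : Type*} [Field K]

/-- No edge covers anything: `covered Λ ∅ = ∅`. [folklore] -/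
theorem covered_empty (Λ : Finset (Site 2)) : covered Λ ∅ = ∅ := by
  simp [covered]

/-- The empty dimer configuration is admissible for every source set. [folklore] -/
theorem empty_mem_dimerConfigs (G : SimpleGraph (Site 2)) [G.LocallyFinite] (Λ A : Finset (Site 2)) :
    (∅ : Finset (Sym2 (Site 2))) ∈ dimerConfigs G Λ A := by
  simp [dimerConfigs]

/-- **At dimer fugacity `t = 0` the dressed SAW is the tree's strictly dilute loop model**:
`Z_{n,0,x}(G, Λ; A) = Z^{tree}_{⟨n,0,x⟩}(G, Λ; A)` (only `M = ∅` survives the factor `(0·x²)^{|M|}`).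
[folklore] -/
theorem dimerPF_dimerFugacity_zero (n x : K) (G : SimpleGraph (Site 2)) [G.LocallyFinite]
    (Λ A : Finset (Site 2)) :
    dimerPF n 0 x G Λ A = (⟨n, 0, x⟩ : DiluteLoopModel K).partitionFunction G Λ A := by
  rw [dimerPF, sum_eq_single_of_mem ∅ (empty_mem_dimerConfigs G Λ A)]
  · simp [covered_empty]
  · intro M _ hM
    simp [zero_pow (card_ne_zero.2 (nonempty_iff_ne_empty.2 hM))]

/-- At `t = 0` the normalised two-leg function of the dressed SAW is the tree's `twoLeg ⟨n, 0, x⟩`.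
[folklore] -/
theorem twoLegDim_dimerFugacity_zero (n x : K) (G : SimpleGraph (Site 2)) [G.LocallyFinite]
    (Λ : Finset (Site 2)) (a b : Site 2) :
    twoLegDim n 0 x G Λ a b = (⟨n, 0, x⟩ : DiluteLoopModel K).twoLeg G Λ a b := by
  rw [twoLegDim, DiluteLoopModel.twoLeg, dimerPF_dimerFugacity_zero, dimerPF_dimerFugacity_zero]

/-- At `t = 0` the doubly normalised ratio of the dressed SAW is the tree's `boundaryRatio ⟨n, 0, x⟩`.
[folklore] -/
theorem ratioDim_dimerFugacity_zero (n x : K) (G' : SimpleGraph (Site 2)) [G'.LocallyFinite]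
    (Λ' : Finset (Site 2)) (G : SimpleGraph (Site 2)) [G.LocallyFinite] (Λ : Finset (Site 2))
    (a b : Site 2) :
    ratioDim n 0 x G' Λ' G Λ a b = (⟨n, 0, x⟩ : DiluteLoopModel K).boundaryRatio G' Λ' G Λ a b := by
  rw [ratioDim, DiluteLoopModel.boundaryRatio, twoLegDim_dimerFugacity_zero,
    twoLegDim_dimerFugacity_zero]

/-- At `t = 0` the route's ratio `R_δ(n, 0, x; Ω, S)` is the tree's boundary ratio of `⟨n, 0, x⟩`
between the confined graph and `Ω_δ` (common volume `meshDomainFinset Ω δ`). [folklore] -/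
theorem Rδ_dimerFugacity_zero (n x : K) (Ω S : Set ℂ) (δ : ℝ) (a b : Site 2) :
    Rδ n 0 x Ω S δ a b = (⟨n, 0, x⟩ : DiluteLoopModel K).boundaryRatio (confinedGraph Ω S δ)
      (meshDomainFinset Ω δ) (discreteDomainGraph Ω δ) (meshDomainFinset Ω δ) a b := by
  rw [Rδ, ratioDim_dimerFugacity_zero]

/-- **`twoLegDim 0 0 x G Λ a b = Σ_{γ ∈ pathsIn G Λ a b} x^{|γ|}`** on subgraphs of `ℤ²`, `a ≠ b`:
at `(n, t) = (0, 0)` the normalised two-leg function is the two-point generating function of the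
self-avoiding paths of `G` from `a` to `b` inside `Λ`. [cite: MadrasSlade1993, §1.2] -/
theorem twoLegDim_zero_zero_eq_sum_paths {G : SimpleGraph (Site 2)} [G.LocallyFinite]
    (hG : G ≤ zdGraph 2) (x : K) (Λ : Finset (Site 2)) {a b : Site 2} (hab : a ≠ b) :
    twoLegDim 0 0 x G Λ a b = ∑ p ∈ DiluteLoopModel.pathsIn G Λ a b, x ^ p.length := by
  rw [twoLegDim_dimerFugacity_zero, DiluteLoopModel.twoLeg_zero_zero_eq_sum_paths hG x Λ hab]

/-- **`R_δ(0, 0, x; Ω, S)` is the ratio of the SAW generating functions** of the confined graph and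
of `Ω_δ` between `a ≠ b` (volume `meshDomainFinset Ω δ`; Lean's `x / 0 = 0` when there is no SAW
from `a` to `b` in `Ω_δ`). [cite: MadrasSlade1993, §1.2] -/
theorem Rδ_zero_zero_eq_div (x : K) (Ω S : Set ℂ) (δ : ℝ) {a b : Site 2} (hab : a ≠ b) :
    Rδ 0 0 x Ω S δ a b =
      (∑ p ∈ DiluteLoopModel.pathsIn (confinedGraph Ω S δ) (meshDomainFinset Ω δ) a b,
          x ^ p.length) /
        ∑ p ∈ DiluteLoopModel.pathsIn (discreteDomainGraph Ω δ) (meshDomainFinset Ω δ) a b,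
          x ^ p.length := by
  rw [Rδ, ratioDim, twoLegDim_zero_zero_eq_sum_paths (confinedGraph_le_zdGraph Ω S δ) x _ hab,
    twoLegDim_zero_zero_eq_sum_paths
      ((discreteDomainGraph_le_meshGraph Ω δ).trans (meshGraph_le_zdGraph Ω δ)) x _ hab]

end DimerFugacityZero

/-! ## Paths of the confined graph = paths of `Ω_δ` whose polyline stays in `closure S` -/

section Confined

variable {Ω S : Set ℂ} {δ : ℝ}

/-- Adjacency in the confined graph, unfolded: an edge of `Ω_δ` whose closed segment lies in
`closure S`. [folklore] -/
theorem confinedGraph_adj_iff {x y : Site 2} :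
    (confinedGraph Ω S δ).Adj x y ↔
      (discreteDomainGraph Ω δ).Adj x y ∧ segment ℝ (meshPoint δ x) (meshPoint δ y) ⊆ closure S := by
  simp only [confinedGraph, SimpleGraph.fromRel_adj, ne_eq]
  constructor
  · rintro ⟨-, h | h⟩
    · exact h
    · exact ⟨h.1.symm, segment_symm ℝ (meshPoint δ y) (meshPoint δ x) ▸ h.2⟩
  · intro h
    exact ⟨h.1.ne, Or.inl h⟩

/-- The polyline of a non-trivial walk of the confined graph stays in `closure S` (it is the union
of the closed segments of its edges). [folklore] -/
theorem range_toCurve_subset_closure {a b : Site 2} (q : (confinedGraph Ω S δ).Walk a b)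
    (hab : a ≠ b) : Set.range (q.toCurve (meshPoint δ)) ⊆ closure S :=
  SimpleGraph.Walk.range_toCurve_subset_of_not_nil (SimpleGraph.Walk.not_nil_of_ne hab)
    fun d _ => (confinedGraph_adj_iff.1 d.adj).2

/-- Conversely, every edge of a walk of `Ω_δ` whose polyline stays in `closure S` is an edge of the
confined graph (each closed edge segment is part of the polyline). [folklore] -/
theorem edges_mem_edgeSet_confinedGraph :
    ∀ {a b : Site 2} (p : (discreteDomainGraph Ω δ).Walk a b),
      Set.range (p.toCurve (meshPoint δ)) ⊆ closure S →
        ∀ e ∈ p.edges, e ∈ (confinedGraph Ω S δ).edgeSet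
  | _, _, .nil, _ => by simp
  | _, _, .cons h p, hS => by
    rw [SimpleGraph.Walk.range_toCurve_cons, Set.union_subset_iff] at hS
    intro e he
    rw [SimpleGraph.Walk.edges_cons, List.mem_cons] at he
    rcases he with rfl | he
    · exact (SimpleGraph.mem_edgeSet _).2 (confinedGraph_adj_iff.2 ⟨h, hS.1⟩)
    · exact edges_mem_edgeSet_confinedGraph p hS.2 e he

/-- Mapping a walk to a supergraph does not change its polyline. [folklore] -/
theorem toCurve_mapLe {V E : Type*} [AddCommGroup E] [Module ℝ E] [TopologicalSpace E]
    [ContinuousAdd E] [ContinuousSMul ℝ E] {G G' : SimpleGraph V} (h : G ≤ G') {u v : V}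
    (p : G.Walk u v) (emb : V → E) : (p.mapLe h).toCurve emb = p.toCurve emb := by
  unfold SimpleGraph.Walk.toCurve
  rw [SimpleGraph.Walk.support_mapLe_eq_support]

/-- Mapping a walk to a supergraph does not change its length. [folklore] -/
theorem length_mapLe {V : Type*} {G G' : SimpleGraph V} (h : G ≤ G') {u v : V} (p : G.Walk u v) :
    (p.mapLe h).length = p.length := by
  rw [← SimpleGraph.Walk.length_edges, SimpleGraph.Walk.edges_mapLe_eq_edges,
    SimpleGraph.Walk.length_edges]

/-- Mapping walks of the confined graph into `Ω_δ` is injective. [folklore] -/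
theorem mapLe_confinedGraph_injective (a b : Site 2) :
    Function.Injective (SimpleGraph.Walk.mapLe (confinedGraph_le Ω S δ) :
      (confinedGraph Ω S δ).Walk a b → (discreteDomainGraph Ω δ).Walk a b) :=
  SimpleGraph.Walk.map_injective_of_injective (fun _ _ h => h) a b

open scoped Classical in
/-- **The self-avoiding paths of `Ω_δ` from `a` to `b ≠ a` inside `Λ` whose polyline stays in
`closure S` are exactly (the images of) the self-avoiding paths of the confined graph
`confinedGraph Ω S δ` inside `Λ`.** (`a ≠ b` matters only for the trivial walk, whose polyline is
the point `δa`.) [folklore] -/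
theorem filter_pathsIn_rangeSubset_eq_image (Λ : Finset (Site 2)) {a b : Site 2} (hab : a ≠ b) :
    (DiluteLoopModel.pathsIn (discreteDomainGraph Ω δ) Λ a b).filter
        (fun p => Set.range (p.toCurve (meshPoint δ)) ⊆ closure S) =
      (DiluteLoopModel.pathsIn (confinedGraph Ω S δ) Λ a b).image
        (SimpleGraph.Walk.mapLe (confinedGraph_le Ω S δ)) := by
  ext p
  simp only [mem_filter, mem_image, DiluteLoopModel.mem_pathsIn]
  constructor
  · rintro ⟨⟨hp, hΛ⟩, hS⟩
    have hE := edges_mem_edgeSet_confinedGraph p hS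
    refine ⟨p.transfer _ hE, ⟨hp.transfer hE, by rwa [SimpleGraph.Walk.support_transfer]⟩, ?_⟩
    have hE' : ∀ e ∈ (p.transfer _ hE).edges, e ∈ (discreteDomainGraph Ω δ).edgeSet := by
      intro e he
      rw [SimpleGraph.Walk.edges_transfer] at he
      exact p.edges_subset_edgeSet he
    change (p.transfer _ hE).map (.ofLE (confinedGraph_le Ω S δ)) = p
    rw [← SimpleGraph.Walk.transfer_eq_map_ofLE _ hE' (confinedGraph_le Ω S δ),
      SimpleGraph.Walk.transfer_transfer, SimpleGraph.Walk.transfer_self]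
  · rintro ⟨q, ⟨hq, hΛ⟩, rfl⟩
    refine ⟨⟨hq.mapLe _, by rwa [SimpleGraph.Walk.support_mapLe_eq_support]⟩, ?_⟩
    rw [toCurve_mapLe]
    exact range_toCurve_subset_closure q hab

end Confined

/-! ## The critical SAW measure of the event -/

section Weight

variable {Ω : Set ℂ} {δ : ℝ} {a b : Site 2}

/-- `x_c = μ⁻¹ ≥ 0` (the connective constant is an infimum of nonnegative reals; this is all the
identity needs — positivity, `SAW.criticalFugacity_pos`, lives in `SAWBridgeRadius.lean`). [folklore] -/
private theorem criticalFugacity_nonneg : 0 ≤ SAW.criticalFugacity :=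
  inv_nonneg.2 (Real.iInf_nonneg fun _ => Real.rpow_nonneg (Nat.cast_nonneg _) _)

/-- The trace of the curve class of a SAW is the trace of its polyline. [folklore] -/
theorem range_curve (γ : SAW.DomainSAW Ω δ a b) :
    γ.curve.range = Set.range (γ.walk.toCurve (meshPoint δ)) := rfl

/-- **The critical SAW measure of the event "the polyline stays in `closure S`" is the SAW
generating function of the confined graph at `x_c`**: `weight {γ : range γ ⊆ closure S} =
ofReal (Σ_{γ ∈ pathsIn (confinedGraph Ω S δ) Ω_δ a b} x_c^{|γ|})`, for a vertex `a` of `Ω_δ` and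
`b ≠ a`. [cite: DuminilCopinSmirnov2012, §4 (before Conjecture 1)] -/
theorem weight_preimage_rangeSubset (ha : a ∈ meshDomainFinset Ω δ) (hab : a ≠ b) (S : Set ℂ) :
    SAW.weight Ω δ a b ((fun γ => γ.curve) ⁻¹' CurveClass.rangeSubset (closure S)) =
      ENNReal.ofReal (∑ p ∈ DiluteLoopModel.pathsIn (confinedGraph Ω S δ) (meshDomainFinset Ω δ) a b,
        SAW.criticalFugacity ^ p.length) := by
  classical
  set T := (fun γ : SAW.DomainSAW Ω δ a b => γ.curve) ⁻¹' CurveClass.rangeSubset (closure S)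
  rw [SAW.weight, Measure.sum_apply _ MeasurableSpace.measurableSet_top]
  simp only [Measure.smul_apply, smul_eq_mul, Measure.dirac_apply' _ MeasurableSpace.measurableSet_top]
  rw [tsum_eq_sum (s := DiluteLoopModel.domainSAWFinset ha)
      (fun γ hγ => absurd (DiluteLoopModel.mem_domainSAWFinset ha γ) hγ),
    ENNReal.ofReal_sum_of_nonneg (fun p _ => pow_nonneg criticalFugacity_nonneg _),
    DiluteLoopModel.domainSAWFinset, sum_map]
  -- the summand only depends on the underlying path
  have key : ∀ p : {p // p ∈ DiluteLoopModel.pathsIn (discreteDomainGraph Ω δ)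
      (meshDomainFinset Ω δ) a b}, ENNReal.ofReal (SAW.criticalFugacity ^
          (⟨p.1, (DiluteLoopModel.mem_pathsIn_discreteDomainGraph ha).1 p.2⟩ :
            SAW.DomainSAW Ω δ a b).length) *
        T.indicator 1 ⟨p.1, (DiluteLoopModel.mem_pathsIn_discreteDomainGraph ha).1 p.2⟩ =
      if Set.range (p.1.toCurve (meshPoint δ)) ⊆ closure S then
        ENNReal.ofReal (SAW.criticalFugacity ^ p.1.length) else 0 := by
    intro p
    by_cases h : Set.range (p.1.toCurve (meshPoint δ)) ⊆ closure S
    · rw [if_pos h, Set.indicator_of_mem (show _ ∈ T from h), Pi.one_apply, mul_one]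
      rfl
    · rw [if_neg h, Set.indicator_of_notMem (show _ ∉ T from h), mul_zero]
  refine (sum_congr rfl fun p _ => key p).trans ?_
  rw [sum_attach (DiluteLoopModel.pathsIn (discreteDomainGraph Ω δ) (meshDomainFinset Ω δ) a b)
      (fun p => if Set.range (p.toCurve (meshPoint δ)) ⊆ closure S then
        ENNReal.ofReal (SAW.criticalFugacity ^ p.length) else 0),
    ← sum_filter, filter_pathsIn_rangeSubset_eq_image _ hab,
    sum_image fun q _ q' _ h => mapLe_confinedGraph_injective a b h]
  exact sum_congr rfl fun q _ => by rw [length_mapLe]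

end Weight

/-! ## The stub -/

/-- **S1 · SAWEndpointIdentity** (stub `stub_sawEndpoint` of line `symplectic-fermion-anchor`).
For bounded `Ω`, `δ > 0` and `a ≠ b`, the critical-SAW probability that the polyline of the walk
from `a` to `b` in `Ω_δ` stays in `closure S` equals the doubly normalised two-leg ratio
`R_δ(0, 0, x_c; Ω, S)` of the loop + dimer dressed SAW: `P_δ(range γ ⊆ closure S) =
Σ_{confined SAWs} x_c^{|γ|} / Σ_{all SAWs} x_c^{|γ|}`; the junk cases (`a ∉ Ω_δ`, or no SAW from `a`
to `b`, where `SAW.law = 0` and the real ratio is `0/0 = 0`) agree.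
[cite: DuminilCopinSmirnov2012, §4 (before Conjecture 1)] -/
theorem stub_sawEndpoint :
    ∀ (Ω S : Set ℂ) (δ : ℝ) (a b : Site 2), Bornology.IsBounded Ω → 0 < δ → a ≠ b →
      ((SAW.law Ω δ a b).map (fun γ => γ.curve)) (CurveClass.rangeSubset (closure S)) =
        ENNReal.ofReal (Rδ (0 : ℝ) 0 SAW.criticalFugacity Ω S δ a b) := by
  intro Ω S δ a b hΩ hδ hab
  rw [Measure.map_apply (SAW.DomainSAW.measurable_of_top _)
      (CurveClass.measurableSet_rangeSubset isClosed_closure),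
    SAW.law, Measure.smul_apply, smul_eq_mul, Rδ_zero_zero_eq_div _ Ω S δ hab]
  by_cases ha : a ∈ meshDomainFinset Ω δ
  · have huniv := DiluteLoopModel.SAW.weight_univ_eq_domainPartitionFunction ha hab
    rw [DiluteLoopModel.domainPartitionFunction_zero_zero_eq_sum_paths _ hab] at huniv
    rw [huniv]
    rcases (sum_nonneg fun p _ => pow_nonneg criticalFugacity_nonneg p.length :
        (0 : ℝ) ≤ ∑ p ∈ DiluteLoopModel.pathsIn (discreteDomainGraph Ω δ) (meshDomainFinset Ω δ) a b,
          SAW.criticalFugacity ^ p.length).eq_or_lt with hD | hD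
    · -- no SAW from `a` to `b` in `Ω_δ` (or `x_c = 0`): `law = 0`, real ratio `0 / 0 = 0`
      have h0 : SAW.weight Ω δ a b Set.univ = 0 := by rw [huniv, ← hD, ENNReal.ofReal_zero]
      rw [measure_mono_null (Set.subset_univ _) h0, mul_zero, ← hD, div_zero, ENNReal.ofReal_zero]
    · rw [weight_preimage_rangeSubset ha hab S, ENNReal.ofReal_div_of_pos hD, div_eq_mul_inv,
        mul_comm]
  · -- `a ∉ Ω_δ`: there is no SAW from `a` to `b ≠ a`, both sides vanish
    have hE : IsEmpty (SAW.DomainSAW Ω δ a b) := ⟨fun γ => ha (by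
      obtain ⟨w, hw, -, -⟩ := γ.walk.exists_eq_cons_of_ne hab
      rw [← mem_coe, coe_meshDomainFinset hΩ hδ]
      exact (discreteDomainGraph_adj_iff.1 hw).2.1)⟩
    have hpaths : DiluteLoopModel.pathsIn (discreteDomainGraph Ω δ) (meshDomainFinset Ω δ) a b = ∅ :=
      eq_empty_of_forall_notMem fun p hp =>
        ha ((DiluteLoopModel.mem_pathsIn.1 hp).2 a p.start_mem_support)
    rw [Set.eq_empty_of_isEmpty ((fun γ : SAW.DomainSAW Ω δ a b => γ.curve) ⁻¹'
        CurveClass.rangeSubset (closure S)), measure_empty, mul_zero, hpaths, sum_empty, div_zero,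
      ENNReal.ofReal_zero]

end Summit.CriticalPhenomena.SAWScalingLimit.Theorems.AvoidanceLimit.Anchor

end
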